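import Literature.AnabelianGeometry.SemiGraphs.TemperedSpecialFibre
import Literature.AnabelianGeometry.SemiGraphs.TemperedPolish
import Literature.AnabelianGeometry.SemiGraphs.TemperedCompactInVerticialAt
import Literature.AnabelianGeometry.SemiGraphs.TemperedVerticialDistinctSameVertex
import Literature.AnabelianGeometry.SemiGraphs.TemperedVerticialNamedFactsProofs
import HarnessLib

/-!
# The action of `Π` on the vertices of the special fibre `𝒢^c` ([SemiAnbd] Ex. 3.10 p. 44): `SpecialFibreData.actVertex`,
# DERIVED from the normality of the admissible kernel and Thm. 3.7 (ii), (iv) (base level of G-w4d063-1)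

Mochizuki, *Semi-graphs of anabelioids*, Publ. RIMS **42** (2006), §3, Example 3.10, manuscript p. 44
[cite: MochizukiSemiAnbd2006, Ex 3.10 p.44] ("`G^c` … associated to the geometric special fiber of the stable model of
`X^log_K`", "the natural quotient `Δ ↠ π₁^temp(G) ≅ π₁^temp(G^c)`", p. 48), with Thm. 3.7 (ii), (iv) pp. 40–41 and the
open mapping theorem for tempered groups (Def. 3.1 (i) p. 33, the tree's `IsTempered.isOpenMap_of_surjective_of_isTempered`);
[IUTchI] §2 p. 47 ("the natural action of `G_k` on `𝔾`") [cite: Mochizuki2012, Cor 2.3 p.47].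

abc-iut cell, seat abc-iut-L3-t2 gen 3 — the BASE-LEVEL twin («level −1», L3-lead gen 5 α26 (1)(iii)) of
`TemperedSpecialFibreTowerVertexAction.lean` (p427708, G-w4d063-1 (P1)): for `D : TemperedArithmeticGroup K`,
special-fibre data `S : SpecialFibreData D` (`S.admissible : Δ ↠ π₁^temp(𝒢^c)`) and the binder
(P0)₀ `hK0 : (S.admissible.toMonoidHom.ker.map D.delta.subtype).Normal` (the admissible kernel is normal in `Π`, not
only in `Δ`; a field of the successor record `PiData`), this file
* PROVES that `S.admissible` is an OPEN map (`Δ` and `π₁^temp(𝒢^c)` are first-countable tempered groups: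
  `isTempered_ker`, the chart's `isTempered` / Galois-countability) — `SpecialFibreData.isOpenMap_admissible`;
* DEFINES `SpecialFibreData.autOfConj hK0 g : π₁^temp(𝒢^c) ≃ₜ* π₁^temp(𝒢^c)`, the automorphism induced by
  conjugation by `g ∈ Π` (`autOfConj_admissible`), multiplicative in `g`, INNER for `g ∈ Δ`;
* DEFINES `SpecialFibreData.actVertex hK0 hiv : Π →* Equiv.Perm S.Gc.graph.Vertex` with its DICTIONARY and PROVES
  that `Δ` acts trivially (`actVertex_coe_eq_one`) — so the action factors through `Π/Δ = G_K`, print's "natural action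
  of `G_K` on `𝔾`" — from Thm. 3.7 (iv) AT `𝒢^c` (binder `hiv : MaximalCompactIffVerticialAt S.Gc`, a theorem at finite
  graphs) and Thm. 3.7 (ii) (`verticialDistinct_holds`).
DEFS-bearing interface item («DEF NEW» posted); no instance, no notation, no `Prop` fact; nothing here bears on
[IUTchIII] Cor. 3.12.
-/

noncomputable section

namespace Literature.AnabelianGeometry.SemiGraphs

open ProfiniteSemiGraph Topology
open scoped Pointwise

universe u

namespace SpecialFibreData

variable {K : Type u} [Field K] {D : TemperedArithmeticGroup K} (S : SpecialFibreData D)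

/-! ### The admissible quotient is open -/

/-- **`Δ ↠ π₁^temp(𝒢^c)` is an open map** (open mapping theorem between first-countable tempered groups: `Δ` is
tempered and second countable, `π₁^temp(𝒢^c)` is tempered and Galois-countable).
[cite: MochizukiSemiAnbd2006, Ex 3.10 p.44] -/
theorem isOpenMap_admissible : IsOpenMap S.admissible := by
  haveI : SecondCountableTopology D.Pi := D.secondCountableTopology
  haveI : SecondCountableTopology (D.aug.toMonoidHom.ker : Subgroup D.Pi) :=
    TopologicalSpace.Subtype.secondCountableTopology _
  haveI : FirstCountableTopology (D.aug.toMonoidHom.ker : Subgroup D.Pi) := inferInstance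
  haveI : SecondCountableTopology S.chart.G := S.chart.secondCountableTopology
  haveI : FirstCountableTopology S.chart.G := inferInstance
  exact D.isTempered_ker.isOpenMap_of_surjective_of_isTempered S.chart.isTempered S.admissible.toMonoidHom
    S.admissible.continuous S.admissible_surjective

/-! ### Conjugation by `Π` on `Δ` -/

/-- Conjugation by `g ∈ Π` on the normal subgroup `Δ = Ker(Π → G_K)`, as a topological-group automorphism of
`Δ`. [cite: MochizukiSemiAnbd2006, Ex 3.10 p.43] -/
def conjDelta (g : D.Pi) : D.delta ≃ₜ* D.delta where
  toFun h := ⟨g * h * g⁻¹, D.delta_normal.conj_mem _ h.2 g⟩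
  invFun h := ⟨g⁻¹ * h * g⁻¹⁻¹, D.delta_normal.conj_mem _ h.2 g⁻¹⟩
  left_inv h := Subtype.ext (by simp only [inv_inv]; group)
  right_inv h := Subtype.ext (by simp only [inv_inv]; group)
  map_mul' h k := Subtype.ext (by simp only [Subgroup.coe_mul]; group)
  continuous_toFun := by
    apply Continuous.subtype_mk
    exact (continuous_const.mul continuous_subtype_val).mul continuous_const
  continuous_invFun := by
    apply Continuous.subtype_mk
    exact (continuous_const.mul continuous_subtype_val).mul continuous_const

/-- `conjDelta g h = g h g⁻¹`. [cite: MochizukiSemiAnbd2006, Ex 3.10 p.43] -/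
@[simp] theorem coe_conjDelta (g : D.Pi) (h : D.delta) : ((conjDelta g h : D.delta) : D.Pi) = g * h * g⁻¹ := rfl

/-- `conjDelta 1 = id`. [cite: MochizukiSemiAnbd2006, Ex 3.10 p.43] -/
theorem conjDelta_one (h : D.delta) : conjDelta 1 h = h := Subtype.ext (by simp)

/-- `conjDelta (g g') = conjDelta g ∘ conjDelta g'`. [cite: MochizukiSemiAnbd2006, Ex 3.10 p.43] -/
theorem conjDelta_mul (g g' : D.Pi) (h : D.delta) : conjDelta (g * g') h = conjDelta g (conjDelta g' h) :=
  Subtype.ext (by simp only [coe_conjDelta]; group)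

/-! ### The induced automorphism of `π₁^temp(𝒢^c)` -/

section Aut

/-- Under (P0)₀, conjugation by `g ∈ Π` preserves the admissible kernel.
[cite: MochizukiSemiAnbd2006, Ex 3.10 p.44] -/
theorem conjDelta_mem_ker (hK0 : (S.admissible.toMonoidHom.ker.map D.delta.subtype).Normal) (g : D.Pi)
    {n : D.delta} (hn : n ∈ S.admissible.toMonoidHom.ker) : conjDelta g n ∈ S.admissible.toMonoidHom.ker := by
  have h1 : ((n : D.delta) : D.Pi) ∈ S.admissible.toMonoidHom.ker.map D.delta.subtype := ⟨n, hn, rfl⟩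
  obtain ⟨m, hm, hmeq⟩ := hK0.conj_mem _ h1 g
  have : m = conjDelta g n := Subtype.ext (by rw [coe_conjDelta]; exact hmeq)
  rw [← this]; exact hm

/-- `admissible ∘ conjDelta g` kills `Ker admissible`. [cite: MochizukiSemiAnbd2006, Ex 3.10 p.44] -/
theorem ker_le_ker_comp (hK0 : (S.admissible.toMonoidHom.ker.map D.delta.subtype).Normal) (g : D.Pi) :
    S.admissible.toMonoidHom.ker ≤ (S.admissible.toMonoidHom.comp (conjDelta g).toMonoidHom).ker := by
  intro n hn
  rw [MonoidHom.mem_ker, MonoidHom.comp_apply]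
  exact S.conjDelta_mem_ker hK0 g hn

/-- The endomorphism of `π₁^temp(𝒢^c)` induced by conjugation by `g` (bare homomorphism): the lift of
`admissible ∘ conjDelta g` along the surjection `admissible`. [cite: MochizukiSemiAnbd2006, Ex 3.10 p.44] -/
def autHom (hK0 : (S.admissible.toMonoidHom.ker.map D.delta.subtype).Normal) (g : D.Pi) :
    S.chart.G →* S.chart.G :=
  S.admissible.toMonoidHom.liftOfSurjective S.admissible_surjective
    ⟨S.admissible.toMonoidHom.comp (conjDelta g).toMonoidHom, S.ker_le_ker_comp hK0 g⟩

/-- The defining square: `autHom g (admissible n) = admissible (g n g⁻¹)`. [cite: MochizukiSemiAnbd2006, Ex 3.10 p.44] -/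
theorem autHom_admissible (hK0 : (S.admissible.toMonoidHom.ker.map D.delta.subtype).Normal) (g : D.Pi)
    (n : D.delta) : S.autHom hK0 g (S.admissible n) = S.admissible (conjDelta g n) :=
  MonoidHom.liftOfRightInverse_comp_apply _ _ _ _ n

/-- `autHom 1 = id`. [cite: MochizukiSemiAnbd2006, Ex 3.10 p.44] -/
theorem autHom_one (hK0 : (S.admissible.toMonoidHom.ker.map D.delta.subtype).Normal) (x : S.chart.G) :
    S.autHom hK0 1 x = x := by
  obtain ⟨n, rfl⟩ := S.admissible_surjective x
  rw [autHom_admissible, conjDelta_one]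

/-- `autHom (g h) = autHom g ∘ autHom h`. [cite: MochizukiSemiAnbd2006, Ex 3.10 p.44] -/
theorem autHom_mul (hK0 : (S.admissible.toMonoidHom.ker.map D.delta.subtype).Normal) (g h : D.Pi)
    (x : S.chart.G) : S.autHom hK0 (g * h) x = S.autHom hK0 g (S.autHom hK0 h x) := by
  obtain ⟨n, rfl⟩ := S.admissible_surjective x
  rw [autHom_admissible, autHom_admissible, autHom_admissible, conjDelta_mul]

/-- `autHom g` is continuous (`admissible` is an open quotient map). [cite: MochizukiSemiAnbd2006, Ex 3.10 p.44] -/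
theorem continuous_autHom (hK0 : (S.admissible.toMonoidHom.ker.map D.delta.subtype).Normal) (g : D.Pi) :
    Continuous (S.autHom hK0 g) := by
  have hq : IsQuotientMap S.admissible :=
    IsOpenMap.isQuotientMap S.isOpenMap_admissible S.admissible.continuous S.admissible_surjective
  rw [hq.continuous_iff]
  have : (S.autHom hK0 g) ∘ S.admissible = S.admissible ∘ (conjDelta g) :=
    funext fun n => S.autHom_admissible hK0 g n
  rw [this]
  exact S.admissible.continuous.comp (conjDelta g).continuous

/-- **The automorphism of `π₁^temp(𝒢^c)` induced by conjugation by `g ∈ Π`.** [cite: MochizukiSemiAnbd2006, Ex 3.10 p.44] -/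
def autOfConj (hK0 : (S.admissible.toMonoidHom.ker.map D.delta.subtype).Normal) (g : D.Pi) :
    S.chart.G ≃ₜ* S.chart.G where
  toFun := S.autHom hK0 g
  invFun := S.autHom hK0 g⁻¹
  left_inv x := by rw [← autHom_mul, inv_mul_cancel, autHom_one]
  right_inv x := by rw [← autHom_mul, mul_inv_cancel, autHom_one]
  map_mul' := map_mul _
  continuous_toFun := S.continuous_autHom hK0 g
  continuous_invFun := S.continuous_autHom hK0 g⁻¹

/-- `autOfConj g (admissible n) = admissible (g n g⁻¹)`. [cite: MochizukiSemiAnbd2006, Ex 3.10 p.44] -/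
theorem autOfConj_admissible (hK0 : (S.admissible.toMonoidHom.ker.map D.delta.subtype).Normal) (g : D.Pi)
    (n : D.delta) : S.autOfConj hK0 g (S.admissible n) = S.admissible (conjDelta g n) :=
  S.autHom_admissible hK0 g n

/-- `autOfConj 1 = id`. [cite: MochizukiSemiAnbd2006, Ex 3.10 p.44] -/
theorem autOfConj_one (hK0 : (S.admissible.toMonoidHom.ker.map D.delta.subtype).Normal) (x : S.chart.G) :
    S.autOfConj hK0 1 x = x := S.autHom_one hK0 x

/-- `autOfConj (g h) = autOfConj g ∘ autOfConj h`. [cite: MochizukiSemiAnbd2006, Ex 3.10 p.44] -/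
theorem autOfConj_mul (hK0 : (S.admissible.toMonoidHom.ker.map D.delta.subtype).Normal) (g h : D.Pi)
    (x : S.chart.G) : S.autOfConj hK0 (g * h) x = S.autOfConj hK0 g (S.autOfConj hK0 h x) :=
  S.autHom_mul hK0 g h x

/-- For `δ ∈ Δ`, `autOfConj δ` is INNER: conjugation by `admissible δ`. [cite: MochizukiSemiAnbd2006, Ex 3.10 p.44] -/
theorem autOfConj_coe (hK0 : (S.admissible.toMonoidHom.ker.map D.delta.subtype).Normal) (δ : D.delta)
    (x : S.chart.G) : S.autOfConj hK0 (δ : D.Pi) x = S.admissible δ * x * (S.admissible δ)⁻¹ := by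
  obtain ⟨m, rfl⟩ := S.admissible_surjective x
  rw [autOfConj_admissible]
  have : conjDelta (δ : D.Pi) m = δ * m * δ⁻¹ := Subtype.ext (by simp)
  rw [this, map_mul, map_mul, map_inv]

end Aut

/-! ### The action on the vertices of `𝒢^c` -/

section Vertices

/-- A topological-group automorphism carries maximal compact subgroups to maximal compact subgroups. [folklore] -/
private theorem isMaximalCompactSubgroup_map {G : Type u} [Group G] [TopologicalSpace G] [IsTopologicalGroup G]
    (e : G ≃ₜ* G) {H : Subgroup G} (hH : IsMaximalCompactSubgroup H) :
    IsMaximalCompactSubgroup (H.map e.toMonoidHom) := by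
  refine ⟨?_, fun H' hH' hle => ?_⟩
  · rw [Subgroup.coe_map]; exact hH.1.image e.continuous
  · have hpre : IsCompact ((H'.map e.symm.toMonoidHom : Subgroup G) : Set G) := by
      rw [Subgroup.coe_map]; exact hH'.image e.symm.continuous
    have hle' : H ≤ H'.map e.symm.toMonoidHom := fun k hk => ⟨e k, hle ⟨k, hk, rfl⟩, e.symm_apply_apply k⟩
    have heq := hH.2 _ hpre hle'
    refine le_antisymm (fun y hy => ?_) hle
    have : e.symm y ∈ H := by rw [← heq]; exact ⟨y, hy, rfl⟩
    exact ⟨e.symm y, this, e.apply_symm_apply y⟩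

/-- Verticial subgroups of `π₁^temp(𝒢^c)` at DISTINCT vertices are distinct (Thm. 3.7 (ii)).
[cite: MochizukiSemiAnbd2006, Thm 3.7(ii) p.40] -/
theorem vertex_eq_of_mem_verticialSubgroups {v w : S.Gc.graph.Vertex} {H : Subgroup S.chart.G}
    (hv : H ∈ verticialSubgroups S.chart v) (hw : H ∈ verticialSubgroups S.chart w) : v = w := by
  by_contra hne
  have h := (verticialDistinct_holds S.Gc S.hyp S.chart).1 v w H H hv hw hne
  rw [Subgroup.relIndex_self] at h
  exact one_ne_zero h

/-- The image of a verticial subgroup under `autOfConj g` is verticial at some vertex (Thm. 3.7 (iv) at `𝒢^c`).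
[cite: MochizukiSemiAnbd2006, Thm 3.7(iv) p.41] -/
theorem exists_vertex_map_autOfConj (hK0 : (S.admissible.toMonoidHom.ker.map D.delta.subtype).Normal)
    (hiv : MaximalCompactIffVerticialAt S.Gc) (g : D.Pi) {v : S.Gc.graph.Vertex} {H : Subgroup S.chart.G}
    (hH : H ∈ verticialSubgroups S.chart v) :
    ∃ w, H.map (S.autOfConj hK0 g).toMonoidHom ∈ verticialSubgroups S.chart w := by
  have hmax : IsMaximalCompactSubgroup H := ((hiv S.hyp S.chart).1 H).2 ⟨v, hH⟩
  exact ((hiv S.hyp S.chart).1 _).1 (isMaximalCompactSubgroup_map (S.autOfConj hK0 g) hmax)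

/-- The verticial subgroups at `v` are nonempty (Thm. 3.7 (i)). [cite: MochizukiSemiAnbd2006, Thm 3.7(i) p.40] -/
theorem verticialSubgroups_nonempty (v : S.Gc.graph.Vertex) : (verticialSubgroups S.chart v).Nonempty :=
  (verticialInjective_holds S.Gc S.hyp S.chart v).1

/-- The vertex `g · v` (as a bare function). [cite: Mochizuki2012, Cor 2.3 p.47] -/
def actFun (hK0 : (S.admissible.toMonoidHom.ker.map D.delta.subtype).Normal)
    (hiv : MaximalCompactIffVerticialAt S.Gc) (g : D.Pi) (v : S.Gc.graph.Vertex) : S.Gc.graph.Vertex :=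
  (S.exists_vertex_map_autOfConj hK0 hiv g (S.verticialSubgroups_nonempty v).some_mem).choose

/-- Images of conjugates: `α(x H x⁻¹) = α(x) α(H) α(x)⁻¹`. [folklore] -/
private theorem map_conj_map {G : Type u} [Group G] [TopologicalSpace G] (e : G ≃ₜ* G) (H : Subgroup G) (x : G) :
    (H.map (MulAut.conj x).toMonoidHom).map e.toMonoidHom =
      (H.map e.toMonoidHom).map (MulAut.conj (e x)).toMonoidHom := by
  rw [Subgroup.map_map, Subgroup.map_map]
  congr 1
  ext y
  show e (x * y * x⁻¹) = e x * e y * (e x)⁻¹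
  rw [map_mul, map_mul, map_inv]

/-- **DICTIONARY, image form**: `autOfConj g` carries every verticial subgroup at `v` to one at `g · v`.
[cite: MochizukiSemiAnbd2006, Thm 3.7(i) p.40] -/
theorem map_mem_verticialSubgroups_actFun (hK0 : (S.admissible.toMonoidHom.ker.map D.delta.subtype).Normal)
    (hiv : MaximalCompactIffVerticialAt S.Gc) (g : D.Pi) {v : S.Gc.graph.Vertex} {H : Subgroup S.chart.G}
    (hH : H ∈ verticialSubgroups S.chart v) :
    H.map (S.autOfConj hK0 g).toMonoidHom ∈ verticialSubgroups S.chart (S.actFun hK0 hiv g v) := by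
  have h₀ := (S.exists_vertex_map_autOfConj hK0 hiv g (S.verticialSubgroups_nonempty v).some_mem).choose_spec
  obtain ⟨x, rfl⟩ := exists_conj_of_mem_verticialSubgroups S.chart (S.verticialSubgroups_nonempty v).some_mem hH
  rw [map_conj_map]
  exact conj_mem_verticialSubgroups S.chart h₀ _

/-- **DICTIONARY**: `g · v = w` iff `autOfConj g` carries every verticial subgroup at `v` to one at `w`.
[cite: Mochizuki2012, Cor 2.3 p.47] -/
theorem actFun_eq_iff (hK0 : (S.admissible.toMonoidHom.ker.map D.delta.subtype).Normal)
    (hiv : MaximalCompactIffVerticialAt S.Gc) (g : D.Pi) (v w : S.Gc.graph.Vertex) :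
    S.actFun hK0 hiv g v = w ↔
      ∀ H ∈ verticialSubgroups S.chart v, H.map (S.autOfConj hK0 g).toMonoidHom ∈ verticialSubgroups S.chart w := by
  constructor
  · rintro rfl H hH
    exact S.map_mem_verticialSubgroups_actFun hK0 hiv g hH
  · intro h
    exact S.vertex_eq_of_mem_verticialSubgroups
      (S.map_mem_verticialSubgroups_actFun hK0 hiv g (S.verticialSubgroups_nonempty v).some_mem)
      (h _ (S.verticialSubgroups_nonempty v).some_mem)

/-- `1 · v = v`. [cite: Mochizuki2012, Cor 2.3 p.47] -/
theorem actFun_one (hK0 : (S.admissible.toMonoidHom.ker.map D.delta.subtype).Normal)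
    (hiv : MaximalCompactIffVerticialAt S.Gc) (v : S.Gc.graph.Vertex) : S.actFun hK0 hiv 1 v = v := by
  rw [actFun_eq_iff]
  intro H hH
  have : H.map (S.autOfConj hK0 1).toMonoidHom = H := by
    ext x
    constructor
    · rintro ⟨y, hy, rfl⟩
      change S.autOfConj hK0 1 y ∈ H
      rw [autOfConj_one]; exact hy
    · intro hx
      exact ⟨x, hx, S.autOfConj_one hK0 x⟩
  rw [this]; exact hH

/-- `(g h) · v = g · (h · v)`. [cite: Mochizuki2012, Cor 2.3 p.47] -/
theorem actFun_mul (hK0 : (S.admissible.toMonoidHom.ker.map D.delta.subtype).Normal)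
    (hiv : MaximalCompactIffVerticialAt S.Gc) (g h : D.Pi) (v : S.Gc.graph.Vertex) :
    S.actFun hK0 hiv (g * h) v = S.actFun hK0 hiv g (S.actFun hK0 hiv h v) := by
  rw [actFun_eq_iff]
  intro H hH
  have hcomp : H.map (S.autOfConj hK0 (g * h)).toMonoidHom =
      (H.map (S.autOfConj hK0 h).toMonoidHom).map (S.autOfConj hK0 g).toMonoidHom := by
    rw [Subgroup.map_map]
    congr 1
    ext x
    exact S.autOfConj_mul hK0 g h x
  rw [hcomp]
  exact S.map_mem_verticialSubgroups_actFun hK0 hiv g (S.map_mem_verticialSubgroups_actFun hK0 hiv h hH)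

/-- **The action of `Π` on the vertices of `𝒢^c`** ([IUTchI] p. 47 "the natural action of `G_k` on `𝔾`" lifted to
`Π^tp_X`). [cite: Mochizuki2012, Cor 2.3 p.47] -/
def actVertex (hK0 : (S.admissible.toMonoidHom.ker.map D.delta.subtype).Normal)
    (hiv : MaximalCompactIffVerticialAt S.Gc) : D.Pi →* Equiv.Perm S.Gc.graph.Vertex where
  toFun g :=
    { toFun := S.actFun hK0 hiv g
      invFun := S.actFun hK0 hiv g⁻¹
      left_inv := fun v => by rw [← actFun_mul, inv_mul_cancel, actFun_one]
      right_inv := fun v => by rw [← actFun_mul, mul_inv_cancel, actFun_one] }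
  map_one' := Equiv.ext fun v => S.actFun_one hK0 hiv v
  map_mul' g h := Equiv.ext fun v => S.actFun_mul hK0 hiv g h v

/-- `actVertex g v = actFun g v`. [cite: Mochizuki2012, Cor 2.3 p.47] -/
theorem actVertex_apply (hK0 : (S.admissible.toMonoidHom.ker.map D.delta.subtype).Normal)
    (hiv : MaximalCompactIffVerticialAt S.Gc) (g : D.Pi) (v : S.Gc.graph.Vertex) :
    S.actVertex hK0 hiv g v = S.actFun hK0 hiv g v := rfl

/-- **DICTIONARY** for `actVertex`. [cite: Mochizuki2012, Cor 2.3 p.47] -/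
theorem actVertex_apply_eq_iff (hK0 : (S.admissible.toMonoidHom.ker.map D.delta.subtype).Normal)
    (hiv : MaximalCompactIffVerticialAt S.Gc) (g : D.Pi) (v w : S.Gc.graph.Vertex) :
    S.actVertex hK0 hiv g v = w ↔
      ∀ H ∈ verticialSubgroups S.chart v, H.map (S.autOfConj hK0 g).toMonoidHom ∈ verticialSubgroups S.chart w :=
  S.actFun_eq_iff hK0 hiv g v w

/-- **`Δ` acts trivially on the vertices of `𝒢^c`** (its elements induce INNER automorphisms of `π₁^temp(𝒢^c)`),
so the action factors through `Π/Δ = G_K`: print's "natural action of `G_K`" on the special fibre.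
[cite: Mochizuki2012, Cor 2.3 p.47] -/
theorem actVertex_coe_eq_one (hK0 : (S.admissible.toMonoidHom.ker.map D.delta.subtype).Normal)
    (hiv : MaximalCompactIffVerticialAt S.Gc) (δ : D.delta) : S.actVertex hK0 hiv (δ : D.Pi) = 1 := by
  ext v
  change S.actFun hK0 hiv (δ : D.Pi) v = v
  rw [actFun_eq_iff]
  intro H hH
  have : H.map (S.autOfConj hK0 (δ : D.Pi)).toMonoidHom = H.map (MulAut.conj (S.admissible δ)).toMonoidHom := by
    congr 1
    ext x
    show S.autOfConj hK0 (δ : D.Pi) x = S.admissible δ * x * (S.admissible δ)⁻¹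
    exact S.autOfConj_coe hK0 δ x
  rw [this]
  exact conj_mem_verticialSubgroups S.chart hH _

/-- `Δ` acts trivially, membership form. [cite: Mochizuki2012, Cor 2.3 p.47] -/
theorem actVertex_eq_one_of_mem_delta (hK0 : (S.admissible.toMonoidHom.ker.map D.delta.subtype).Normal)
    (hiv : MaximalCompactIffVerticialAt S.Gc) (g : D.Pi) (hg : g ∈ D.delta) : S.actVertex hK0 hiv g = 1 :=
  S.actVertex_coe_eq_one hK0 hiv ⟨g, hg⟩

end Vertices

end SpecialFibreData

end Literature.AnabelianGeometry.SemiGraphs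

end
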